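import Summits.BirchSwinnertonDyer.BirchSwinnertonDyer.Theorems.ThetaPartnerAtTwoSignedKatoUpToAtTwoPrimitiveCharValues
import Summits.BirchSwinnertonDyer.BirchSwinnertonDyer.Theorems.ThetaPartnerAtTwoSignedKatoUpToAtTwoCoreOfCharValues
import Literature.NumberTheory.EllipticCurves.Sprung2017.SharpFlatPAdicLFunctionTwoProofs
import HarnessLib

/-!
# Route `ThetaPartnerAtTwo` (TP2), crux K3 `SignedKatoDivisibilityUpToAtTwo` (item stmt-BirchSwinnertonDyer-20308) /
# K3P′ (stmt-BirchSwinnertonDyer-25631), line `colemanrat` v11 — «PRIMITIVE CHARACTERS SUFFICE» for the character-value socket: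
# CORE_χ ⟸ CORE_χ^prim

Width seat `bsd-wall-tp2-p2x-w3` g6 (cell `bsd-wall`). HONEST FRAMING: one implication between fully spelled statements (no definition,
no named fact, no instance, no `sorry`); closes no item; K3 / K3P′ are NOT settled and BSD is NOT proved by any of this.

## What is here

`coreChi_of_coreChiPrim : CORE_χ^prim → CORE_χ`, where CORE_χ is the character-value socket of the registered PUB stub
`stub_katoFiniteErlTwo` (`…CoreOfCharValues.lean`: `core_fin_of_coreChi : CORE_χ → CORE_fin`) and CORE_χ^prim is CORE_χ with the
(ERL_χ) identity «`ν(χ(γ)−1)·χ(P_{n,d_n}(col₀ s)) = μ(χ(γ)−1)·ratTwistedSymbolSum f χ`» required ONLY for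
  (i) PRIMITIVE `χ` (conductor exactly `2^{n+2}` — where Birch's formula reads `∑_a χ(a)[a/2^{n+2}]⁺ = τ(χ)·L(f, χ̄, 1)/Ω⁺` with no
      Euler-factor corrections, and Kato's Thm. 12.5 (1) value is the primitive twisted `L`-value), and
 (ii) the levels `n ≤ 1` (i.e. additionally the trivial character at `n = 0, 1`; Kato's value law covers `χ = 1` with the
      `{2}`-depleted `L`-value).
Proof: strong induction on `n`. An imprimitive even `2`-power-order `χ` modulo `2^{n+2}`, `n = m+2`, factors through `2^{n+1}`, so
`ζ = χ(γ)` has `ζ^{2^{m+1}} = 1` (`γ = 5` has order `2^{m+1}` modulo `2^{m+3}`); both sides of (ERL_χ) then drop two levels by the SAME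
factor `−Φ_{2^{m+1}}(ζ) = −(1 + ζ^{2^m})` (`…PrimitiveCharValues.lean`: θ-side `eval₂_mazurTateElement_add_two_eq` = the three-term relation of
Mazur–Tate at `a₂ = 0`; P-side `sum_evalOn_pow_smul_add_two_eq` = the trace relation (TR) of the plus Honda points); if `ζ^{2^m} = 1` the
identity at level `m` for a character `χ'` of `G_m` with `χ'(γ) = ζ` (`exists_even_char_apply_cyclotomicGenerator_eq`) is the induction
hypothesis, and if `ζ^{2^m} = −1` both sides vanish.

So for the typer: an X stating Kato 12.5 (1) + Birch at PRIMITIVE characters of every conductor `2^{n+2}` (plus `χ = 1` at `n = 0, 1`)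
closes the registered stub through `core_fin_of_coreChi ∘ coreChi_of_coreChiPrim`.

References: [MazurTateTeitelbaum1986Invent] §I.10 (10.2), §I.13; [Kobayashi2003] Thm. 6.3 (proof, p. 25), §8.4; [Kato2004Asterisque]
Thm. 12.5 (1) (pp. 221–222), Thm. 6.6; [Washington1997] §7.2.
-/

set_option autoImplicit false
-- the Theorems namespace of this sub repeats the summit name by design (D-0017 nested layout)
set_option linter.dupNamespace false

noncomputable section

open scoped Classical MatrixGroups ModularForm NumberField

open CongruenceSubgroup WeierstrassCurve Field IsDedekindDomain NumberField Polynomial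
  Literature.NumberTheory.GaloisRepresentations
  Literature.NumberTheory.EllipticCurves Literature.NumberTheory.EllipticCurves.ModularForms
  Literature.NumberTheory.EllipticCurves.Module Literature.NumberTheory.EllipticCurves.Rank1Residual
  Literature.NumberTheory.EllipticCurves.Kobayashi2003 Literature.NumberTheory.EllipticCurves.Kato2004
  Literature.NumberTheory.EllipticCurves.Kato2004.EulerSystemValues Literature.NumberTheory.EllipticCurves.GreenbergSelmer
  Literature.NumberTheory.EllipticCurves.Sprung2012 Literature.NumberTheory.EllipticCurves.Sprung2017
  ZpExtension Summit.BirchSwinnertonDyer.Rank1Residual.Supersingular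

namespace Summit.BirchSwinnertonDyer.BirchSwinnertonDyer.Theorems.SignedKatoOffTwo.CoreChi

/-! ## §5 Imprimitive characters of `G_{m+2}` -/

/-- **An imprimitive even `2`-power-order character modulo `2^{m+4}` comes from `G_{m+1}`**: `χ(γ)^{2^{m+1}} = 1`. Its conductor is
a proper `2`-power divisor of `2^{m+4}`, so `χ` factors through `2^{m+3}` (`mem_conductorSet_iff_conductor_dvd`), and `γ = 5` has order
`2^{m+1}` modulo `2^{m+3}` (`orderOf_cyclotomicGenerator`). [cite: Washington1997, §7.2] [cite: MazurTateTeitelbaum1986Invent, §I.13] -/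
theorem apply_cyclotomicGenerator_pow_eq_one_of_not_isPrimitive (m : ℕ)
    (χ : DirichletCharacter ℂ_[2] (2 ^ (m + 2 + cyclotomicExponent 2))) (hnp : ¬ χ.IsPrimitive) :
    χ (cyclotomicGenerator 2 : ZMod (2 ^ (m + 2 + cyclotomicExponent 2))) ^ 2 ^ (m + 1) = 1 := by
  haveI : NeZero (2 ^ (m + 2 + cyclotomicExponent 2)) := ⟨pow_ne_zero _ two_ne_zero⟩
  have hdvdM : 2 ^ (m + 1 + cyclotomicExponent 2) ∣ 2 ^ (m + 2 + cyclotomicExponent 2) := pow_dvd_pow 2 (by omega)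
  have hcond : χ.conductor ∣ 2 ^ (m + 1 + cyclotomicExponent 2) := by
    obtain ⟨k, hk, hck⟩ := (Nat.dvd_prime_pow Nat.prime_two).1 (DirichletCharacter.conductor_dvd_level χ)
    have hk' : k ≠ m + 2 + cyclotomicExponent 2 := fun h ↦ hnp (by rw [DirichletCharacter.isPrimitive_def, hck, h])
    rw [hck]
    exact pow_dvd_pow 2 (by omega)
  have hfac : χ.FactorsThrough (2 ^ (m + 1 + cyclotomicExponent 2)) :=
    (DirichletCharacter.mem_conductorSet_iff_conductor_dvd χ hdvdM).mpr hcond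
  obtain ⟨u, hu⟩ := isUnit_cyclotomicGenerator_cast 2 (m + 2 + cyclotomicExponent 2)
  -- `γ^{2^{m+1}} ≡ 1 (mod 2^{m+3})`: the unit `u^{2^{m+1}}` dies under `unitsMap`
  have hγ : (cyclotomicGenerator 2 : ZMod (2 ^ (m + 1 + cyclotomicExponent 2))) ^ 2 ^ (m + 1) = 1 := by
    have h := pow_orderOf_eq_one (cyclotomicGenerator 2 : ZMod (2 ^ (m + 1 + cyclotomicExponent 2)))
    rwa [orderOf_cyclotomicGenerator 2 (m + 1)] at h
  have hker : u ^ 2 ^ (m + 1) ∈ (ZMod.unitsMap hdvdM).ker := by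
    rw [MonoidHom.mem_ker]
    ext
    rw [map_pow, Units.val_pow_eq_pow_val, ZMod.unitsMap_val, hu, ZMod.cast_natCast hdvdM, hγ, Units.val_one]
  have h1 := (DirichletCharacter.factorsThrough_iff_ker_unitsMap hdvdM).mp hfac hker
  rw [MonoidHom.mem_ker] at h1
  have h2 := congrArg Units.val h1
  rw [MulChar.coe_toUnitHom, Units.val_pow_eq_pow_val, hu, map_pow, Units.val_one] at h2
  exact h2

/-! ## §6 The socket CORE_χ ⟸ CORE_χ^prim -/

/-- Bounded coefficients of `Λ`-elements pushed to `ℂ₂` (plumbing). [folklore] -/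
private theorem hbd_two' (G : PowerSeries ℤ_[2]) (k : ℕ) :
    ‖((algebraMap ℚ_[2] ℂ_[2]).comp (algebraMap ℤ_[2] ℚ_[2])) (PowerSeries.coeff k G)‖ ≤ 1 :=
  norm_algebraMap_coeff_le_one G k

/-- **CORE_χ ⟸ CORE_χ^prim («primitive characters suffice»).** Hypothesis CORE_χ^prim: the character-value socket CORE_χ (hypothesis of
`core_fin_of_coreChi`) with the (ERL_χ) identity asked only for `χ` PRIMITIVE (conductor `2^{n+2}`) or `n ≤ 1`. Conclusion: CORE_χ
verbatim. Strong induction on `n`; imprimitive `χ` at level `m+2` has `χ(γ)^{2^{m+1}} = 1`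
(`apply_cyclotomicGenerator_pow_eq_one_of_not_isPrimitive`) and both sides of (ERL_χ) equal `−(1 + χ(γ)^{2^m})` times the level-`m`
sides (`sum_evalOn_pow_smul_add_two_eq`, `eval₂_mazurTateElement_add_two_eq`); level `m` is the induction hypothesis at a character
`χ'` of `G_m` with `χ'(γ) = χ(γ)` when `χ(γ)^{2^m} = 1`, and both sides vanish when `χ(γ)^{2^m} = −1`. CONDITIONAL on the hypothesis
only; closes nothing by itself. [cite: Kato2004Asterisque, Thm. 12.5 (1) (pp. 221–222)] [cite: Kobayashi2003, Thm. 6.3 (proof, p. 25)]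
[cite: MazurTateTeitelbaum1986Invent, §I.10 Prop. (10.2)] -/
theorem coreChi_of_coreChiPrim
    (hprim :
      ∀ (v : HeightOneSpectrum (𝓞 ℚ)), ((2 : ℕ) : 𝓞 ℚ) ∈ v.asIdeal →
      ∀ (W : WeierstrassCurve ℚ) [W.IsElliptic] [W.IsGloballyMinimal],
        ¬ W.HasCM → W.analyticRank = 0 → GoodSS W 2 → W.frobeniusTrace 2 = 0 →
        ∀ (κ : ZpExtension ℚ 2) (γ : Field.absoluteGaloisGroup ℚ) (hκ : κ.IsCyclotomic),
          κ.IsTopGenerator γ → IsCyclotomicVariable 2 γ →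
          ∀ [NeZero (W.conductorNorm ℤ)] (f : CuspForm (Gamma0 (W.conductorNorm ℤ)) 2),
            IsNewformOf W f → ∀ (ϖ : ℚ), (ϖ : ℝ) * W.realPeriodRat = plusPeriod f →
          ∀ (Lplus Lminus : IwasawaAlgebra 2), IsPollackPair f 2 Lplus Lminus →
          ∀ [ContinuousSMul ℤ_[2] (W.tateModule 2)] [Module.Free ℤ_[2] (W.tateModule 2)]
            [Module.Finite ℤ_[2] (W.tateModule 2)],
          ∀ 𝔭 : PrimeSpectrum (IwasawaAlgebra 2), 𝔭.asIdeal.height = 1 →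
            PowerSeries.C (2 : ℤ_[2]) ∉ 𝔭.asIdeal →
          ∀ (I : Kato2004.IwasawaH1Data W 2 κ γ)
            (pair : ∀ n : ℕ, H1 (tateRep W 2) (κ.layerSubgroup n) →ₗ[ℤ_[2]]
              (localLayerPointsOfEmb κ (closureEmb (K := ℚ) (v.adicCompletion ℚ)) W n →+ ℤ_[2])),
            -- (P1) projection formula
            (∀ (n : ℕ) (x : H1 (tateRep W 2) (κ.layerSubgroup (n + 1))) (Q : localPoints W (v.adicCompletion ℚ))
              (hQ : Q ∈ localLayerPointsOfEmb κ (closureEmb (K := ℚ) (v.adicCompletion ℚ)) W n),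
              pair n (layerCores (tateRep W 2) κ n x) ⟨Q, hQ⟩ =
                pair (n + 1) x ⟨Q, localLayerPointsOfEmb_mono κ (closureEmb (K := ℚ) (v.adicCompletion ℚ)) W (Nat.le_succ n) hQ⟩) →
            -- (P2) Galois invariance, for EVERY `g ∈ Γ_v`
            (∀ (n : ℕ) (g : absoluteGaloisGroup (v.adicCompletion ℚ)) (y : H1 (tateRep W 2) (κ.layerSubgroup n))
              (Q : localPoints W (v.adicCompletion ℚ))
              (hQ : Q ∈ localLayerPointsOfEmb κ (closureEmb (K := ℚ) (v.adicCompletion ℚ)) W n),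
              pair n (conjMap (tateRep W 2).toTopRep (κ.layerSubgroup n) (resGalOfEmb (closureEmb (K := ℚ) (v.adicCompletion ℚ)) g) 1 y)
                ⟨g • Q, smul_mem_localLayerPointsOfEmb κ (closureEmb (K := ℚ) (v.adicCompletion ℚ)) W n g hQ⟩ = pair n y ⟨Q, hQ⟩) →
            -- (P3) `pair` IS the `T₂E`-adic local Tate pairing: residues = the (D-layer) pairings for THE Weil pairings of the tree
            (∀ (n k : ℕ) (x : H1 (tateRep W 2) (κ.layerSubgroup n))
              (Q : localLayerPointsOfEmb κ (closureEmb (K := ℚ) (v.adicCompletion ℚ)) W n),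
              PadicInt.toZModPow k (pair n x Q) =
                LayerPairing.layerPairingPk W κ v (LayerPairing.weilTowerPk W) (LayerPairing.weilTowerPk_pow W)
                  (LayerPairing.weilTowerPk_add_left W) (LayerPairing.weilTowerPk_add_right W) (LayerPairing.weilTowerPk_smul W)
                  n k x Q) →
          ∃ (g : absoluteGaloisGroup (v.adicCompletion ℚ))
            (_ : κ.IsTopGenerator (resGalOfEmb (closureEmb (K := ℚ) (v.adicCompletion ℚ)) g))
            (d : ℕ → localPoints W (v.adicCompletion ℚ)) (s : I.H),
            (∀ n, d n ∈ localLayerPointsOfEmb κ (closureEmb (K := ℚ) (v.adicCompletion ℚ)) W n) ∧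
            (∀ n, localTraceOfEmb κ (closureEmb (K := ℚ) (v.adicCompletion ℚ)) W (n + 1) (n + 2) (d (n + 2)) = -d n) ∧
            (∀ n : ℕ, 1 ≤ n → ∀ P ∈ localLayerPointsOfEmb κ (closureEmb (K := ℚ) (v.adicCompletion ℚ)) W n,
              ∃ B ∈ AddSubgroup.closure (Set.range fun σ : absoluteGaloisGroup (v.adicCompletion ℚ) ↦ σ • d n),
                ∃ P' ∈ localLayerPointsOfEmb κ (closureEmb (K := ℚ) (v.adicCompletion ℚ)) W (n - 1),
                ∃ R ∈ localLayerPointsOfEmb κ (closureEmb (K := ℚ) (v.adicCompletion ℚ)) W n, P = B + P' + 2 • R) ∧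
            (∀ P ∈ localLayerPointsOfEmb κ (closureEmb (K := ℚ) (v.adicCompletion ℚ)) W 0,
              ∃ a : ℤ, ∃ R ∈ localLayerPointsOfEmb κ (closureEmb (K := ℚ) (v.adicCompletion ℚ)) W 0, P = a • d 0 + 2 • R) ∧
            Kato2004.IsEulerSystemClassTwo W hκ I s ∧
            (∀ col₀ : I.H →+ (localTowerPointsOfEmb κ (closureEmb (K := ℚ) (v.adicCompletion ℚ)) W →+ ℤ_[2]),
              (∀ (n : ℕ) (x : I.H) (Q : localPoints W (v.adicCompletion ℚ)) (hQ : Q ∈ localLayerPointsOfEmb κ (closureEmb (K := ℚ) (v.adicCompletion ℚ)) W n),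
                col₀ x ⟨Q, localLayerPointsOfEmb_le_localTowerPointsOfEmb κ (closureEmb (K := ℚ) (v.adicCompletion ℚ)) W n hQ⟩ = pair n (I.proj n x) ⟨Q, hQ⟩) →
              ∃ μ ν : IwasawaAlgebra 2, μ ∉ 𝔭.asIdeal ∧ ν ∉ 𝔭.asIdeal ∧
                ∀ (n : ℕ) (χ : DirichletCharacter ℂ_[2] (2 ^ (n + cyclotomicExponent 2))),
                  χ.Even → (∃ j : ℕ, orderOf χ = 2 ^ j) → (χ.IsPrimitive ∨ n ≤ 1) →
                  (∑' k, ((algebraMap ℚ_[2] ℂ_[2]).comp (algebraMap ℤ_[2] ℚ_[2])) (PowerSeries.coeff k ν) *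
                      (χ (cyclotomicGenerator 2 : ZMod (2 ^ (n + cyclotomicExponent 2))) - 1) ^ k) *
                    (∑' k, ((algebraMap ℚ_[2] ℂ_[2]).comp (algebraMap ℤ_[2] ℚ_[2]))
                        (PowerSeries.coeff k (pairingSum W (localTowerPointsOfEmb κ (closureEmb (K := ℚ) (v.adicCompletion ℚ)) W)
                          g n (d n) (col₀ s))) *
                      (χ (cyclotomicGenerator 2 : ZMod (2 ^ (n + cyclotomicExponent 2))) - 1) ^ k) =
                  (∑' k, ((algebraMap ℚ_[2] ℂ_[2]).comp (algebraMap ℤ_[2] ℚ_[2])) (PowerSeries.coeff k μ) *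
                      (χ (cyclotomicGenerator 2 : ZMod (2 ^ (n + cyclotomicExponent 2))) - 1) ^ k) *
                    ratTwistedSymbolSum f χ)) :
    ∀ (v : HeightOneSpectrum (𝓞 ℚ)), ((2 : ℕ) : 𝓞 ℚ) ∈ v.asIdeal →
      ∀ (W : WeierstrassCurve ℚ) [W.IsElliptic] [W.IsGloballyMinimal],
        ¬ W.HasCM → W.analyticRank = 0 → GoodSS W 2 → W.frobeniusTrace 2 = 0 →
        ∀ (κ : ZpExtension ℚ 2) (γ : Field.absoluteGaloisGroup ℚ) (hκ : κ.IsCyclotomic),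
          κ.IsTopGenerator γ → IsCyclotomicVariable 2 γ →
          ∀ [NeZero (W.conductorNorm ℤ)] (f : CuspForm (Gamma0 (W.conductorNorm ℤ)) 2),
            IsNewformOf W f → ∀ (ϖ : ℚ), (ϖ : ℝ) * W.realPeriodRat = plusPeriod f →
          ∀ (Lplus Lminus : IwasawaAlgebra 2), IsPollackPair f 2 Lplus Lminus →
          ∀ [ContinuousSMul ℤ_[2] (W.tateModule 2)] [Module.Free ℤ_[2] (W.tateModule 2)]
            [Module.Finite ℤ_[2] (W.tateModule 2)],
          ∀ 𝔭 : PrimeSpectrum (IwasawaAlgebra 2), 𝔭.asIdeal.height = 1 →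
            PowerSeries.C (2 : ℤ_[2]) ∉ 𝔭.asIdeal →
          ∀ (I : Kato2004.IwasawaH1Data W 2 κ γ)
            (pair : ∀ n : ℕ, H1 (tateRep W 2) (κ.layerSubgroup n) →ₗ[ℤ_[2]]
              (localLayerPointsOfEmb κ (closureEmb (K := ℚ) (v.adicCompletion ℚ)) W n →+ ℤ_[2])),
            -- (P1) projection formula
            (∀ (n : ℕ) (x : H1 (tateRep W 2) (κ.layerSubgroup (n + 1))) (Q : localPoints W (v.adicCompletion ℚ))
              (hQ : Q ∈ localLayerPointsOfEmb κ (closureEmb (K := ℚ) (v.adicCompletion ℚ)) W n),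
              pair n (layerCores (tateRep W 2) κ n x) ⟨Q, hQ⟩ =
                pair (n + 1) x ⟨Q, localLayerPointsOfEmb_mono κ (closureEmb (K := ℚ) (v.adicCompletion ℚ)) W (Nat.le_succ n) hQ⟩) →
            -- (P2) Galois invariance, for EVERY `g ∈ Γ_v`
            (∀ (n : ℕ) (g : absoluteGaloisGroup (v.adicCompletion ℚ)) (y : H1 (tateRep W 2) (κ.layerSubgroup n))
              (Q : localPoints W (v.adicCompletion ℚ))
              (hQ : Q ∈ localLayerPointsOfEmb κ (closureEmb (K := ℚ) (v.adicCompletion ℚ)) W n),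
              pair n (conjMap (tateRep W 2).toTopRep (κ.layerSubgroup n) (resGalOfEmb (closureEmb (K := ℚ) (v.adicCompletion ℚ)) g) 1 y)
                ⟨g • Q, smul_mem_localLayerPointsOfEmb κ (closureEmb (K := ℚ) (v.adicCompletion ℚ)) W n g hQ⟩ = pair n y ⟨Q, hQ⟩) →
            -- (P3) `pair` IS the `T₂E`-adic local Tate pairing: residues = the (D-layer) pairings for THE Weil pairings of the tree
            (∀ (n k : ℕ) (x : H1 (tateRep W 2) (κ.layerSubgroup n))
              (Q : localLayerPointsOfEmb κ (closureEmb (K := ℚ) (v.adicCompletion ℚ)) W n),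
              PadicInt.toZModPow k (pair n x Q) =
                LayerPairing.layerPairingPk W κ v (LayerPairing.weilTowerPk W) (LayerPairing.weilTowerPk_pow W)
                  (LayerPairing.weilTowerPk_add_left W) (LayerPairing.weilTowerPk_add_right W) (LayerPairing.weilTowerPk_smul W)
                  n k x Q) →
          ∃ (g : absoluteGaloisGroup (v.adicCompletion ℚ))
            (_ : κ.IsTopGenerator (resGalOfEmb (closureEmb (K := ℚ) (v.adicCompletion ℚ)) g))
            (d : ℕ → localPoints W (v.adicCompletion ℚ)) (s : I.H),
            (∀ n, d n ∈ localLayerPointsOfEmb κ (closureEmb (K := ℚ) (v.adicCompletion ℚ)) W n) ∧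
            (∀ n, localTraceOfEmb κ (closureEmb (K := ℚ) (v.adicCompletion ℚ)) W (n + 1) (n + 2) (d (n + 2)) = -d n) ∧
            (∀ n : ℕ, 1 ≤ n → ∀ P ∈ localLayerPointsOfEmb κ (closureEmb (K := ℚ) (v.adicCompletion ℚ)) W n,
              ∃ B ∈ AddSubgroup.closure (Set.range fun σ : absoluteGaloisGroup (v.adicCompletion ℚ) ↦ σ • d n),
                ∃ P' ∈ localLayerPointsOfEmb κ (closureEmb (K := ℚ) (v.adicCompletion ℚ)) W (n - 1),
                ∃ R ∈ localLayerPointsOfEmb κ (closureEmb (K := ℚ) (v.adicCompletion ℚ)) W n, P = B + P' + 2 • R) ∧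
            (∀ P ∈ localLayerPointsOfEmb κ (closureEmb (K := ℚ) (v.adicCompletion ℚ)) W 0,
              ∃ a : ℤ, ∃ R ∈ localLayerPointsOfEmb κ (closureEmb (K := ℚ) (v.adicCompletion ℚ)) W 0, P = a • d 0 + 2 • R) ∧
            Kato2004.IsEulerSystemClassTwo W hκ I s ∧
            (∀ col₀ : I.H →+ (localTowerPointsOfEmb κ (closureEmb (K := ℚ) (v.adicCompletion ℚ)) W →+ ℤ_[2]),
              (∀ (n : ℕ) (x : I.H) (Q : localPoints W (v.adicCompletion ℚ)) (hQ : Q ∈ localLayerPointsOfEmb κ (closureEmb (K := ℚ) (v.adicCompletion ℚ)) W n),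
                col₀ x ⟨Q, localLayerPointsOfEmb_le_localTowerPointsOfEmb κ (closureEmb (K := ℚ) (v.adicCompletion ℚ)) W n hQ⟩ = pair n (I.proj n x) ⟨Q, hQ⟩) →
              ∃ μ ν : IwasawaAlgebra 2, μ ∉ 𝔭.asIdeal ∧ ν ∉ 𝔭.asIdeal ∧
                ∀ (n : ℕ) (χ : DirichletCharacter ℂ_[2] (2 ^ (n + cyclotomicExponent 2))),
                  χ.Even → (∃ j : ℕ, orderOf χ = 2 ^ j) →
                  (∑' k, ((algebraMap ℚ_[2] ℂ_[2]).comp (algebraMap ℤ_[2] ℚ_[2])) (PowerSeries.coeff k ν) *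
                      (χ (cyclotomicGenerator 2 : ZMod (2 ^ (n + cyclotomicExponent 2))) - 1) ^ k) *
                    (∑' k, ((algebraMap ℚ_[2] ℂ_[2]).comp (algebraMap ℤ_[2] ℚ_[2]))
                        (PowerSeries.coeff k (pairingSum W (localTowerPointsOfEmb κ (closureEmb (K := ℚ) (v.adicCompletion ℚ)) W)
                          g n (d n) (col₀ s))) *
                      (χ (cyclotomicGenerator 2 : ZMod (2 ^ (n + cyclotomicExponent 2))) - 1) ^ k) =
                  (∑' k, ((algebraMap ℚ_[2] ℂ_[2]).comp (algebraMap ℤ_[2] ℚ_[2])) (PowerSeries.coeff k μ) *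
                      (χ (cyclotomicGenerator 2 : ZMod (2 ^ (n + cyclotomicExponent 2))) - 1) ^ k) *
                    ratTwistedSymbolSum f χ) := by
  intro v hv W _ _ hcm hr hss ha κ γ hκ hγ hvar _ f hf ϖ hϖ Lplus Lminus hPol _ _ _ 𝔭 h𝔭 h2 I pair hP1 hP2 hP3
  obtain ⟨g, hg, d, s, hL, hTR, hGEN, hGEN0, hES, hCHI⟩ :=
    hprim v hv W hcm hr hss ha κ γ hκ hγ hvar f hf ϖ hϖ Lplus Lminus hPol 𝔭 h𝔭 h2 I pair hP1 hP2 hP3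
  refine ⟨g, hg, d, s, hL, hTR, hGEN, hGEN0, hES, fun col₀ hglue ↦ ?_⟩
  obtain ⟨μ, ν, hμ, hν, hval⟩ := hCHI col₀ hglue
  refine ⟨μ, ν, hμ, hν, ?_⟩
  -- newform bookkeeping for the three-term relation
  have hf0 : IsNewform0 f := hf.1
  have hQ : coeffField f = ⊥ := hf.coeffField_eq_bot
  have hpN : ¬ 2 ∣ W.conductorNorm ℤ := not_dvd_level_of_isNewformOf hf hss.1
  have hap : cuspCoeff f 2 = ((0 : ℤ) : ℂ) := by
    rw [cuspCoeff_eq_frobeniusTrace_of_isNewformOf_holds hf hss.1, ha]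
  set ιZ : ℤ_[2] →+* ℂ_[2] := (algebraMap ℚ_[2] ℂ_[2]).comp (algebraMap ℤ_[2] ℚ_[2]) with hιZ
  intro n
  induction n using Nat.strong_induction_on with
  | _ n ih =>
  intro χ hev hord
  by_cases hbase : χ.IsPrimitive ∨ n ≤ 1
  · exact hval n χ hev hord hbase
  have hnp : ¬ χ.IsPrimitive := fun h ↦ hbase (Or.inl h)
  have hn : ¬ n ≤ 1 := fun h ↦ hbase (Or.inr h)
  obtain ⟨m, rfl⟩ : ∃ m, n = m + 2 := ⟨n - 2, by omega⟩
  set ζ : ℂ_[2] := χ (cyclotomicGenerator 2 : ZMod (2 ^ (m + 2 + cyclotomicExponent 2))) with hζdef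
  have hζ1 : ζ ^ 2 ^ (m + 1) = 1 := apply_cyclotomicGenerator_pow_eq_one_of_not_isPrimitive m χ hnp
  -- the two distribution relations and Birch at level `m + 2`
  have hP := sum_evalOn_pow_smul_add_two_eq κ (closureEmb (K := ℚ) (v.adicCompletion ℚ)) W ιZ hg hL m (hTR m) (col₀ s) hζ1
  have hθ := eval₂_mazurTateElement_add_two_eq hf0 hQ hpN hap m hζ1
  have hB := eval₂_mazurTateElement_eq_ratTwistedSymbolSum f χ hev hord
  rw [← hζdef] at hB
  rw [tsum_coeff_pairingSum_mul_pow_eq_sum, hP, ← hB, hθ]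
  by_cases hA : ζ ^ 2 ^ m = 1
  · -- descend to a character of `G_m` with the same `χ(γ)`
    obtain ⟨χ', hev', hord', hχ'⟩ := exists_even_char_apply_cyclotomicGenerator_eq m hA
    have hIH := ih m (by omega) χ' hev' hord'
    have hB' := eval₂_mazurTateElement_eq_ratTwistedSymbolSum f χ' hev' hord'
    rw [hχ'] at hIH hB'
    rw [tsum_coeff_pairingSum_mul_pow_eq_sum, ← hB'] at hIH
    linear_combination (-(∑ i ∈ Finset.range 2, ζ ^ (2 ^ m * i))) * hIH
  · -- `ζ^{2^m} = -1`: both sides vanish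
    have hsq : (ζ ^ 2 ^ m) ^ 2 = 1 := by rw [← pow_mul, ← pow_succ, hζ1]
    have hneg : ζ ^ 2 ^ m = -1 := (sq_eq_one_iff.mp hsq).resolve_left hA
    have hS : ∑ i ∈ Finset.range 2, ζ ^ (2 ^ m * i) = 0 := by
      rw [Finset.sum_range_succ, Finset.sum_range_succ, Finset.sum_range_zero, zero_add, mul_zero, pow_zero, mul_one, hneg]
      ring
    rw [hS]
    ring

end Summit.BirchSwinnertonDyer.BirchSwinnertonDyer.Theorems.SignedKatoOffTwo.CoreChi

end
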